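import Mathlib
import Summits.RiemannHypothesis.RiemannHypothesis.Theorems.HandoffRankOnePencil
import HarnessLib

/-!
# HANDOFF — ONE NEGATIVE DIRECTION: inertia of a form that is non-negative on a hyperplane, and the SECULAR EQUATION of the
# rank-one pencil on a ladder (cell rh-explicit, TRACK «HANDOFF», seat theory-2 gen11; FILE XII-x; finite-dimensional folklore)

HONEST FRAMING. Nothing in this file bears on the truth of RH; every statement is elementary real linear algebra / one-variable
calculus. It types the algebra behind a DATA finding of the cell (theory-2 gen11, 2026-08-24, DERIVED-CHECK single-lineage on
cc-s2-3's certified cc6-hp case files; sealed prediction file `PRED-SECULAR-theory2-g11` c8ed94d4):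
* in 45/45 (cc-s2-3, block-Ritz) + 16/16 (cc-s2-5, B-kink) + 40/40 (this seat's census) certified-NEGATIVE window cells of the
  semilocal Weil form `Q_{S_q}` at bandwidths `(log q)/2 + δ`, q = 5 … 43, the section has EXACTLY ONE negative direction; the
  second eigenvalue of the finite-dimensional Birman–Schwinger operator `G_F⁻¹N` (`G_F` = section of the full form, `N = G_F − G_S`
  the prime-q atom) is `μ₂ ∈ [0.059, 0.139]` in 66/66 cells while `μ₁ > 1 ⟺` the cell is negative (66/66);
* in the odd sector the whole bottom of the `G_S` spectrum (ε₁ and the next three block-Ritz values, strictly interlacing the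
  near-null LADDER `λ₀ < λ₁ < …` of `G_F`, one per gap) is reproduced by the scalar secular equation `Σ_k gain_k/(λ_k − λ) + R = 1`
  built from each file's own near-null table, and the bottom vector's interior-node pattern is that of the ONE ladder mode
  `m̂ = argmax_k √gain_k/(λ_k + |ε₁|)` (13/13 cells; P-LAD-2 of the sealed file aea1d505 HIT on K43).
What the kernel checks here is only the ALGEBRA those sentences use:
§1 a real quadratic form that is `≥ 0` on a hyperplane `{x | ℓ·x = 0}` has no negative-definite 2-plane, hence no two orthogonal
   eigenvectors with negative eigenvalues (`not_two_orthogonal_negative_eigenvectors`) — «at most ONE negative direction»;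
§2 three instances: the rank-one pencil `A − t·v vᵀ` (`A ⪰ 0`, `t ≥ 0`; hyperplane `v⊥`), the LIFT CERTIFICATE read backwards
   (`G + t·u uᵀ ⪰ 0 ⟹ G ≥ 0 on u⊥`: cc-s2-5's «rank-one-lift inertia certificate» instrument), and the variational form of
   «second Birman–Schwinger eigenvalue ≤ 1» (`N ≤ A` on a hyperplane ⟹ `A − N ≥ 0` there);
§3 the DIAGONAL SECULAR PENCIL `diag(E) − s·a aᵀ` (`E_k > 0` the ladder, `a_k` the edge couplings, `s > 0`): an eigenvalue
   off the ladder solves the secular equation `s·Σ_k a_k²/(E_k − λ) = 1` with eigenvector `a_k/(E_k − λ)` and conversely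
   (`secular_of_eigen`, `eigen_of_secular`); the secular function is strictly increasing on every pole-free interval
   (`secularFn_lt`), so there is AT MOST ONE eigenvalue below the ladder and at most one in each ladder gap, NONE above the top rung
   when all couplings are live (`not_eigen_above`) — «the pencil only LOWERS the ladder, one eigenvalue per gap»; a NEGATIVE
   eigenvalue exists iff the capacity `s·Σ a_k²/E_k` exceeds 1 (`exists_neg_secular_root_iff`), recovering XII-l's crossing
   criterion with the explicit eigenvector; and the MODE-ABSORPTION identity `x_j·(E_j − λ)·a_k = x_k·(E_k − λ)·a_j`
   (`eigen_component_ratio`): as `−λ` climbs past successive rungs the negative eigenvector takes over the ladder modes one by one.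
What is NOT here (DATA/MODEL, not kernel): that the prime atom acts on the near-null ladder as ONE coherent direction (the atom
matrix itself has rank ≫ 1: its spectrum is `±‖N‖` on the layer rows), the identification of kappa.py's near-null modes with
the profiled node patterns, any statement about `N → ∞`, and anything about ζ. References (folklore): Sylvester's law of inertia;
the Birman–Schwinger principle (M. Sh. Birman, Mat. Sb. 55 (1961); J. Schwinger, PNAS 47 (1961)); the secular equation of a
rank-one modification (J. R. Bunch, C. P. Nielsen, D. C. Sorensen, Numer. Math. 31 (1978) 31–48; G. H. Golub, SIAM Rev. 15 (1973)
318–334), as read in standard texts. Companion: `HandoffRankOnePencil` (XII-l: `A − t·v vᵀ ⪰ 0 ↔ t⟨v, A⁻¹v⟩ ≤ 1`).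
-/

set_option linter.dupNamespace false  -- the mandated namespace repeats `RiemannHypothesis`

open Matrix Finset

namespace Summit.RiemannHypothesis.RiemannHypothesis.Theorems.HandoffSecularPencil

variable {n : Type*} [Fintype n]

/-! ## §1 A form non-negative on a hyperplane has at most one negative direction -/

/-- If the real quadratic form `x ↦ x·(P x)` is non-negative on the hyperplane `{x | ℓ·x = 0}`, then every 2-plane contains a
non-zero combination on which the form is non-negative: for all `x, y` there are `α, β`, not both zero, with
`0 ≤ (αx + βy)·P(αx + βy)`. (Take `α = ℓ·y`, `β = −ℓ·x`, or `(1, 0)` when both vanish.) [folklore] -/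
theorem exists_combination_nonneg (P : Matrix n n ℝ) (ℓ : n → ℝ) (h : ∀ x, ℓ ⬝ᵥ x = 0 → 0 ≤ x ⬝ᵥ (P *ᵥ x)) (x y : n → ℝ) :
    ∃ α β : ℝ, (α ≠ 0 ∨ β ≠ 0) ∧ 0 ≤ (α • x + β • y) ⬝ᵥ (P *ᵥ (α • x + β • y)) := by
  by_cases hx : ℓ ⬝ᵥ x = 0
  · refine ⟨1, 0, Or.inl one_ne_zero, ?_⟩
    have : (1 : ℝ) • x + (0 : ℝ) • y = x := by simp
    rw [this]
    exact h x hx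
  · refine ⟨ℓ ⬝ᵥ y, -(ℓ ⬝ᵥ x), Or.inr (neg_ne_zero.mpr hx), h _ ?_⟩
    rw [dotProduct_add, dotProduct_smul, dotProduct_smul, smul_eq_mul, smul_eq_mul]
    ring

/-- **ONE NEGATIVE DIRECTION.** If `x ↦ x·(P x)` is non-negative on a hyperplane `{x | ℓ·x = 0}`, then `P` does not have two
mutually orthogonal eigenvectors with negative eigenvalues. (On `αx + βy` the form equals `α²λ‖x‖² + β²μ‖y‖² < 0` for
`(α, β) ≠ 0` — using only `Px = λx`, `Py = μy`, `x·y = 0`; no symmetry of `P` is needed.) For a real symmetric matrix this says: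
at most ONE negative eigenvalue counted with multiplicity (distinct eigenvalues have orthogonal eigenvectors, and a 2-dimensional
negative eigenspace contains an orthogonal pair). [folklore: Sylvester / Courant–Fischer for index ≤ 1] -/
theorem not_two_orthogonal_negative_eigenvectors (P : Matrix n n ℝ) (ℓ : n → ℝ)
    (h : ∀ x, ℓ ⬝ᵥ x = 0 → 0 ≤ x ⬝ᵥ (P *ᵥ x)) {x y : n → ℝ} {lam mu : ℝ} (hx : x ≠ 0) (hy : y ≠ 0)
    (hxy : x ⬝ᵥ y = 0) (hPx : P *ᵥ x = lam • x) (hPy : P *ᵥ y = mu • y) (hlam : lam < 0) (hmu : mu < 0) : False := by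
  obtain ⟨α, β, hαβ, hq⟩ := exists_combination_nonneg P ℓ h x y
  have hyx : y ⬝ᵥ x = 0 := by rw [dotProduct_comm]; exact hxy
  have e : (α • x + β • y) ⬝ᵥ (P *ᵥ (α • x + β • y)) = α ^ 2 * lam * (x ⬝ᵥ x) + β ^ 2 * mu * (y ⬝ᵥ y) := by
    rw [mulVec_add, mulVec_smul, mulVec_smul, hPx, hPy, add_dotProduct, smul_dotProduct, smul_dotProduct, dotProduct_add,
      dotProduct_add, dotProduct_smul, dotProduct_smul, dotProduct_smul, dotProduct_smul, dotProduct_smul, dotProduct_smul,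
      dotProduct_smul, dotProduct_smul, hxy, hyx]
    simp only [smul_eq_mul, mul_zero, add_zero, zero_add]
    ring
  rw [e] at hq
  have hxx : 0 < x ⬝ᵥ x := by
    rcases (dotProduct_self_star_nonneg x).lt_or_eq with hpos | hzero
    · simpa using hpos
    · exact absurd (dotProduct_self_eq_zero.mp (by simpa using hzero.symm)) hx
  have hyy : 0 < y ⬝ᵥ y := by
    rcases (dotProduct_self_star_nonneg y).lt_or_eq with hpos | hzero
    · simpa using hpos
    · exact absurd (dotProduct_self_eq_zero.mp (by simpa using hzero.symm)) hy
  have h1 : α ^ 2 * lam * (x ⬝ᵥ x) ≤ 0 :=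
    mul_nonpos_of_nonpos_of_nonneg (mul_nonpos_of_nonneg_of_nonpos (sq_nonneg α) hlam.le) hxx.le
  have h2 : β ^ 2 * mu * (y ⬝ᵥ y) ≤ 0 :=
    mul_nonpos_of_nonpos_of_nonneg (mul_nonpos_of_nonneg_of_nonpos (sq_nonneg β) hmu.le) hyy.le
  rcases hαβ with hα | hβ
  · have : α ^ 2 * lam * (x ⬝ᵥ x) < 0 :=
      mul_neg_of_neg_of_pos (mul_neg_of_pos_of_neg (by positivity) hlam) hxx
    linarith
  · have : β ^ 2 * mu * (y ⬝ᵥ y) < 0 :=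
      mul_neg_of_neg_of_pos (mul_neg_of_pos_of_neg (by positivity) hmu) hyy
    linarith

/-- No negative-definite 2-plane: if the form is `≥ 0` on a hyperplane, there are no `x, y` with `x·Px < 0`, `y·Py < 0` spanning a
plane on which the form is negative at every non-zero point. Stated as: it is impossible that the form is negative at EVERY
non-trivial combination of `x` and `y`. [folklore] -/
theorem not_negative_on_plane (P : Matrix n n ℝ) (ℓ : n → ℝ) (h : ∀ x, ℓ ⬝ᵥ x = 0 → 0 ≤ x ⬝ᵥ (P *ᵥ x)) (x y : n → ℝ) :
    ¬ ∀ α β : ℝ, (α ≠ 0 ∨ β ≠ 0) → (α • x + β • y) ⬝ᵥ (P *ᵥ (α • x + β • y)) < 0 := by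
  intro hneg
  obtain ⟨α, β, hαβ, hq⟩ := exists_combination_nonneg P ℓ h x y
  exact absurd (hneg α β hαβ) (not_lt.mpr hq)

/-! ## §2 Instances: the rank-one pencil, the lift certificate, the second Birman–Schwinger eigenvalue -/

/-- The value of `vecMulVec v v *ᵥ x` at `k`: `(v·x)·v k`. [folklore] -/
theorem vecMulVec_mulVec_apply' (v x : n → ℝ) (k : n) : (vecMulVec v v *ᵥ x) k = (v ⬝ᵥ x) * v k := by
  rw [Matrix.vecMulVec_mulVec, op_smul_eq_smul, Pi.smul_apply, smul_eq_mul]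

/-- The rank-one pencil `A − t·v vᵀ` with `x·Ax ≥ 0` for all `x` (any real `t`) is non-negative on the hyperplane `v⊥`. [folklore] -/
theorem pencil_nonneg_on_perp (A : Matrix n n ℝ) (hA : ∀ x : n → ℝ, 0 ≤ x ⬝ᵥ (A *ᵥ x)) (v : n → ℝ) {t : ℝ}
    (x : n → ℝ) (hx : v ⬝ᵥ x = 0) : 0 ≤ x ⬝ᵥ ((A - t • vecMulVec v v) *ᵥ x) := by
  rw [HandoffRankOnePencil.dotProduct_pencil_mulVec, hx]
  simpa using hA x

/-- **The rank-one pencil has at most one negative direction**: for `x·Ax ≥ 0` (all `x`), any `t`, the matrix `A − t·v vᵀ` has no two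
orthogonal eigenvectors with negative eigenvalues. (A rank-one modification moves the inertia by at most one.) [folklore] -/
theorem pencil_not_two_negative (A : Matrix n n ℝ) (hA : ∀ x : n → ℝ, 0 ≤ x ⬝ᵥ (A *ᵥ x)) (v : n → ℝ) (t : ℝ)
    {x y : n → ℝ} {lam mu : ℝ} (hx : x ≠ 0) (hy : y ≠ 0) (hxy : x ⬝ᵥ y = 0)
    (hPx : (A - t • vecMulVec v v) *ᵥ x = lam • x) (hPy : (A - t • vecMulVec v v) *ᵥ y = mu • y)
    (hlam : lam < 0) (hmu : mu < 0) : False :=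
  not_two_orthogonal_negative_eigenvectors _ v (fun z hz ↦ pencil_nonneg_on_perp A hA v z hz) hx hy hxy hPx hPy hlam hmu

/-- **The LIFT CERTIFICATE read backwards** (cc-s2-5's «rank-one-lift inertia certificate»): if `G + t·u uᵀ` is non-negative as a
form (e.g. its `λ_min` is CERTIFIED `≥ 0`) then `G` is non-negative on `u⊥`… [folklore] -/
theorem nonneg_on_perp_of_lift (G : Matrix n n ℝ) (u : n → ℝ) (t : ℝ)
    (hlift : ∀ x : n → ℝ, 0 ≤ x ⬝ᵥ ((G + t • vecMulVec u u) *ᵥ x)) (x : n → ℝ) (hx : u ⬝ᵥ x = 0) :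
    0 ≤ x ⬝ᵥ (G *ᵥ x) := by
  have h := hlift x
  rw [add_mulVec, smul_mulVec, dotProduct_add, dotProduct_smul] at h
  have hz : x ⬝ᵥ (vecMulVec u u *ᵥ x) = 0 := by
    rw [Matrix.vecMulVec_mulVec, op_smul_eq_smul, dotProduct_smul, hx, zero_smul]
  rwa [hz, smul_zero, add_zero] at h

/-- … hence `G` has no two orthogonal eigenvectors with negative eigenvalues: a certified `λ_min(G + t·u uᵀ) ≥ 0` certifies
«inertia of `G` ≤ 1». [folklore] -/
theorem not_two_negative_of_lift (G : Matrix n n ℝ) (u : n → ℝ) (t : ℝ)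
    (hlift : ∀ x : n → ℝ, 0 ≤ x ⬝ᵥ ((G + t • vecMulVec u u) *ᵥ x)) {x y : n → ℝ} {lam mu : ℝ} (hx : x ≠ 0) (hy : y ≠ 0)
    (hxy : x ⬝ᵥ y = 0) (hPx : G *ᵥ x = lam • x) (hPy : G *ᵥ y = mu • y) (hlam : lam < 0) (hmu : mu < 0) : False :=
  not_two_orthogonal_negative_eigenvectors G u (nonneg_on_perp_of_lift G u t hlift) hx hy hxy hPx hPy hlam hmu

/-- **Second Birman–Schwinger eigenvalue ≤ 1, variational form.** If the perturbation `N` is dominated by `A` on some hyperplane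
`{x | ℓ·x = 0}` (`x·Nx ≤ x·Ax` there — for `A ≻ 0` this is what «the Birman–Schwinger operator `A⁻¹N` has at most one eigenvalue
above 1» means, by Courant–Fischer), then `A − N` is non-negative on that hyperplane, so `A − N` has at most one negative direction
(`not_two_orthogonal_negative_eigenvectors`). The cell's case files report `μ₂(G_F⁻¹N) ≤ 0.14` (66/66). [folklore] -/
theorem sub_nonneg_on_hyperplane (A N : Matrix n n ℝ) (ℓ : n → ℝ)
    (hdom : ∀ x : n → ℝ, ℓ ⬝ᵥ x = 0 → x ⬝ᵥ (N *ᵥ x) ≤ x ⬝ᵥ (A *ᵥ x)) (x : n → ℝ) (hx : ℓ ⬝ᵥ x = 0) :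
    0 ≤ x ⬝ᵥ ((A - N) *ᵥ x) := by
  rw [sub_mulVec, dotProduct_sub, sub_nonneg]
  exact hdom x hx

/-! ## §3 The diagonal secular pencil `diag(E) − s·a aᵀ` -/

section Secular

variable {ι : Type*} [Fintype ι] [DecidableEq ι]

/-! Throughout §3 the LADDER PENCIL is the explicit matrix `diagonal E - s • vecMulVec a a` and the SECULAR FUNCTION is the
explicit expression `s * ∑ k, a k ^ 2 / (E k - lam)` (no auxiliary definitions, so that the file stays theorems-only). -/

/-- Action of the ladder pencil: `(P x)_k = E_k x_k − s (a·x) a_k`. [folklore] -/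
theorem ladderPencil_mulVec_apply (E a : ι → ℝ) (s : ℝ) (x : ι → ℝ) (k : ι) :
    ((diagonal E - s • vecMulVec a a) *ᵥ x) k = E k * x k - s * (a ⬝ᵥ x) * a k := by
  rw [sub_mulVec, smul_mulVec, Pi.sub_apply, Pi.smul_apply, mulVec_diagonal, vecMulVec_mulVec_apply',
    smul_eq_mul, mul_assoc]

/-- **Eigen ⟹ secular.** If `P x = λ x` with `x ≠ 0` and `λ` is not a rung (`E_k ≠ λ` for all `k`), then `a·x ≠ 0`, every component
is `x_k = s (a·x) a_k/(E_k − λ)`, and `λ` solves the secular equation `s·Σ a_k²/(E_k − λ) = 1`. [folklore: Golub 1973,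
Bunch–Nielsen–Sorensen 1978] -/
theorem secular_of_eigen {E a : ι → ℝ} {s lam : ℝ} {x : ι → ℝ} (hx : (diagonal E - s • vecMulVec a a) *ᵥ x = lam • x)
    (hlam : ∀ k, E k ≠ lam) (hx0 : x ≠ 0) :
    a ⬝ᵥ x ≠ 0 ∧ (∀ k, x k = s * (a ⬝ᵥ x) * a k / (E k - lam)) ∧ (s * ∑ k, a k ^ 2 / (E k - lam)) = 1 := by
  have hk : ∀ k, x k * (E k - lam) = s * (a ⬝ᵥ x) * a k := by
    intro k
    have h := congr_fun hx k
    rw [ladderPencil_mulVec_apply, Pi.smul_apply, smul_eq_mul] at h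
    linarith
  have hcomp : ∀ k, x k = s * (a ⬝ᵥ x) * a k / (E k - lam) := by
    intro k
    rw [eq_div_iff (sub_ne_zero.mpr (hlam k))]
    exact hk k
  have hax : a ⬝ᵥ x ≠ 0 := by
    intro h0
    apply hx0
    funext k
    rw [hcomp k, h0, mul_zero, zero_mul, zero_div, Pi.zero_apply]
  refine ⟨hax, hcomp, ?_⟩
  -- a·x = Σ a_k x_k = s (a·x) Σ a_k²/(E_k − λ)
  have hsum : a ⬝ᵥ x = (a ⬝ᵥ x) * (s * ∑ k, a k ^ 2 / (E k - lam)) := by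
    calc a ⬝ᵥ x = ∑ k, a k * x k := rfl
      _ = ∑ k, a k * (s * (a ⬝ᵥ x) * a k / (E k - lam)) := Finset.sum_congr rfl fun k _ ↦ by rw [← hcomp k]
      _ = (a ⬝ᵥ x) * (s * ∑ k, a k ^ 2 / (E k - lam)) := by
        rw [← mul_assoc, mul_comm (a ⬝ᵥ x) s, Finset.mul_sum]
        exact Finset.sum_congr rfl fun k _ ↦ by rw [sq]; ring
  have h1 : (a ⬝ᵥ x) * (s * ∑ k, a k ^ 2 / (E k - lam)) = (a ⬝ᵥ x) * 1 := by rw [mul_one]; exact hsum.symm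
  exact mul_left_cancel₀ hax h1

/-- **Secular ⟹ eigen.** If `λ` is not a rung and solves `s·Σ a_k²/(E_k − λ) = 1`, then `x_k := a_k/(E_k − λ)` is an eigenvector
of the ladder pencil with eigenvalue `λ` (it is non-zero as soon as some `a_k ≠ 0`). [folklore] -/
theorem eigen_of_secular {E a : ι → ℝ} {s lam : ℝ} (hlam : ∀ k, E k ≠ lam) (hsec : (s * ∑ k, a k ^ 2 / (E k - lam)) = 1) :
    (diagonal E - s • vecMulVec a a) *ᵥ (fun k ↦ a k / (E k - lam)) = lam • (fun k ↦ a k / (E k - lam)) := by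
  have hax : s * (a ⬝ᵥ fun k ↦ a k / (E k - lam)) = 1 := by
    rw [← hsec, dotProduct]
    congr 1
    refine Finset.sum_congr rfl fun k _ ↦ ?_
    rw [sq, mul_div_assoc]
  funext k
  rw [ladderPencil_mulVec_apply, hax, Pi.smul_apply, smul_eq_mul, one_mul]
  have hk : E k - lam ≠ 0 := sub_ne_zero.mpr (hlam k)
  field_simp
  ring

/-- **MODE ABSORPTION.** For an eigenvector off the ladder, `x_j·(E_j − λ)·a_k = x_k·(E_k − λ)·a_j`: the weight of rung `j`
relative to rung `k` is `(a_j/a_k)·(E_k − λ)/(E_j − λ)` — rungs far below `−λ` enter with their full coupling `a_j`, rungs far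
above are suppressed by `(−λ)/E_k`. As `−λ` climbs the ladder the ONE negative eigenvector takes over the modes one by one (the
node-count staircase of the cell's bottom vectors). [folklore] -/
theorem eigen_component_ratio {E a : ι → ℝ} {s lam : ℝ} {x : ι → ℝ} (hx : (diagonal E - s • vecMulVec a a) *ᵥ x = lam • x)
    (hlam : ∀ k, E k ≠ lam) (hx0 : x ≠ 0) (j k : ι) : x j * (E j - lam) * a k = x k * (E k - lam) * a j := by
  obtain ⟨-, hcomp, -⟩ := secular_of_eigen hx hlam hx0
  rw [hcomp j, hcomp k, div_mul_cancel₀ _ (sub_ne_zero.mpr (hlam j)), div_mul_cancel₀ _ (sub_ne_zero.mpr (hlam k))]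
  ring

/-- Auxiliary: for `c ≥ 0` and `d₂ < d₁ < 0`, `c/d₁ ≤ c/d₂`. [folklore] -/
theorem div_le_div_of_neg_left' {c d₁ d₂ : ℝ} (hc : 0 ≤ c) (h : d₂ < d₁) (h1 : d₁ < 0) (h2 : d₂ < 0) :
    c / d₁ ≤ c / d₂ := by
  rw [le_div_iff_of_neg h2, div_mul_eq_mul_div, le_div_iff_of_neg h1]
  exact mul_le_mul_of_nonneg_left h.le hc

/-- Auxiliary, strict: for `c > 0` and `d₂ < d₁ < 0`, `c/d₁ < c/d₂`. [folklore] -/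
theorem div_lt_div_of_neg_left' {c d₁ d₂ : ℝ} (hc : 0 < c) (h : d₂ < d₁) (h1 : d₁ < 0) (h2 : d₂ < 0) :
    c / d₁ < c / d₂ := by
  rw [lt_div_iff_of_neg h2, div_mul_eq_mul_div, lt_div_iff_of_neg h1]
  exact mul_lt_mul_of_pos_left h hc

omit [DecidableEq ι] in
/-- **The secular function is strictly increasing on every pole-free interval**: if `λ < μ`, no rung lies in `[λ, μ]`
(each `E_k < λ` or `μ < E_k`), `s > 0` and some coupling `a_k ≠ 0`, then `φ(λ) < φ(μ)`. Hence AT MOST ONE eigenvalue of the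
ladder pencil lies below the ladder, and at most one in each gap between consecutive rungs («one eigenvalue per gap»: the upper
half of interlacing). [folklore] -/
theorem secularFn_lt {E a : ι → ℝ} {s lam mu : ℝ} (hs : 0 < s) (hlm : lam < mu) (hfree : ∀ k, E k < lam ∨ mu < E k)
    (ha : ∃ k, a k ≠ 0) : (s * ∑ k, a k ^ 2 / (E k - lam)) < (s * ∑ k, a k ^ 2 / (E k - mu)) := by
  refine mul_lt_mul_of_pos_left (Finset.sum_lt_sum (fun k _ ↦ ?_) ?_) hs
  · rcases hfree k with hk | hk
    · exact div_le_div_of_neg_left' (sq_nonneg (a k)) (by linarith) (by linarith) (by linarith)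
    · exact div_le_div_of_nonneg_left (sq_nonneg (a k)) (by linarith) (by linarith)
  · obtain ⟨k, hk0⟩ := ha
    refine ⟨k, Finset.mem_univ k, ?_⟩
    have hpos : 0 < a k ^ 2 := by positivity
    rcases hfree k with hk | hk
    · exact div_lt_div_of_neg_left' hpos (by linarith) (by linarith) (by linarith)
    · exact div_lt_div_of_pos_left hpos (by linarith) (by linarith)

/-- **At most one eigenvalue below the ladder** (in particular at most one NEGATIVE eigenvalue when the rungs are positive): two
eigenvalues `λ, μ` of the ladder pencil that both lie below every rung coincide (`s > 0`, some `a_k ≠ 0`). [folklore] -/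
theorem eigenvalue_below_ladder_unique {E a : ι → ℝ} {s lam mu : ℝ} {x y : ι → ℝ} (hs : 0 < s) (ha : ∃ k, a k ≠ 0)
    (hx : (diagonal E - s • vecMulVec a a) *ᵥ x = lam • x) (hy : (diagonal E - s • vecMulVec a a) *ᵥ y = mu • y) (hx0 : x ≠ 0) (hy0 : y ≠ 0)
    (hlam : ∀ k, lam < E k) (hmu : ∀ k, mu < E k) : lam = mu := by
  have hl := (secular_of_eigen hx (fun k ↦ (hlam k).ne') hx0).2.2
  have hm := (secular_of_eigen hy (fun k ↦ (hmu k).ne') hy0).2.2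
  by_contra hne
  rcases lt_or_gt_of_ne hne with hlt | hgt
  · have := secularFn_lt hs hlt (fun k ↦ Or.inr (hmu k)) ha
    rw [hl, hm] at this
    exact lt_irrefl _ this
  · have := secularFn_lt hs hgt (fun k ↦ Or.inr (hlam k)) ha
    rw [hl, hm] at this
    exact lt_irrefl _ this

/-- **At most one eigenvalue per ladder gap**: two eigenvalues in the same window `(lo, hi)` containing no rung coincide
(`s > 0`, some `a_k ≠ 0`). [folklore] -/
theorem eigenvalue_in_gap_unique {E a : ι → ℝ} {s lam mu lo hi : ℝ} {x y : ι → ℝ} (hs : 0 < s) (ha : ∃ k, a k ≠ 0)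
    (hx : (diagonal E - s • vecMulVec a a) *ᵥ x = lam • x) (hy : (diagonal E - s • vecMulVec a a) *ᵥ y = mu • y) (hx0 : x ≠ 0) (hy0 : y ≠ 0)
    (hgap : ∀ k, E k ≤ lo ∨ hi ≤ E k) (hlam : lo < lam ∧ lam < hi) (hmu : lo < mu ∧ mu < hi) : lam = mu := by
  have hfl : ∀ k, E k ≠ lam := fun k h ↦ by rcases hgap k with h' | h' <;> linarith [hlam.1, hlam.2]
  have hfm : ∀ k, E k ≠ mu := fun k h ↦ by rcases hgap k with h' | h' <;> linarith [hmu.1, hmu.2]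
  have hl := (secular_of_eigen hx hfl hx0).2.2
  have hm := (secular_of_eigen hy hfm hy0).2.2
  have free1 : ∀ k, E k < lam ∨ mu < E k := fun k ↦ by
    rcases hgap k with h' | h'
    · exact Or.inl (by linarith [hlam.1])
    · exact Or.inr (by linarith [hmu.2])
  have free2 : ∀ k, E k < mu ∨ lam < E k := fun k ↦ by
    rcases hgap k with h' | h'
    · exact Or.inl (by linarith [hmu.1])
    · exact Or.inr (by linarith [hlam.2])
  by_contra hne
  rcases lt_or_gt_of_ne hne with hlt | hgt
  · have := secularFn_lt hs hlt free1 ha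
    rw [hl, hm] at this
    exact lt_irrefl _ this
  · have := secularFn_lt hs hgt free2 ha
    rw [hl, hm] at this
    exact lt_irrefl _ this

/-- **The pencil only LOWERS the ladder**: for `s > 0` no eigenvalue lies strictly above every rung (there `φ(λ) ≤ 0 < 1`).
[folklore] -/
theorem not_eigen_above {E a : ι → ℝ} {s lam : ℝ} {x : ι → ℝ} (hs : 0 < s) (hx : (diagonal E - s • vecMulVec a a) *ᵥ x = lam • x)
    (hx0 : x ≠ 0) (habove : ∀ k, E k < lam) : False := by
  have h := (secular_of_eigen hx (fun k ↦ (habove k).ne) hx0).2.2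
  have hle : (s * ∑ k, a k ^ 2 / (E k - lam)) ≤ 0 := by
    refine mul_nonpos_of_nonneg_of_nonpos hs.le (Finset.sum_nonpos fun k _ ↦ ?_)
    exact div_nonpos_of_nonneg_of_nonpos (sq_nonneg _) (by linarith [habove k])
  linarith

omit [DecidableEq ι] in
/-- Capacity of the ladder pencil: `φ(0) = s·Σ a_k²/E_k` (XII-l's resolvent value `t⟨v, A⁻¹v⟩` for `A = diag(E)`). [folklore] -/
theorem secularFn_zero (E a : ι → ℝ) (s : ℝ) : (s * ∑ k, a k ^ 2 / (E k - 0)) = s * ∑ k, a k ^ 2 / E k := by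
  simp

omit [DecidableEq ι] in
/-- The secular function is continuous on `(−∞, 0]` when all rungs are positive. [folklore] -/
theorem continuousOn_secularFn {E a : ι → ℝ} (s : ℝ) (hE : ∀ k, 0 < E k) :
    ContinuousOn (fun lam ↦ (s * ∑ k, a k ^ 2 / (E k - lam))) (Set.Iic 0) := by
  refine continuousOn_const.mul (continuousOn_finsetSum _ fun k _ ↦ ?_)
  refine continuousOn_const.div (continuousOn_const.sub continuousOn_id) fun lam hlam ↦ ?_
  have : lam ≤ 0 := hlam
  linarith [hE k]

omit [DecidableEq ι] in
/-- For `λ < 0` and positive rungs, `φ(λ) ≤ s·(Σ a_k²)/(−λ)` (`s ≥ 0`): the secular function tends to `0` at `−∞`. [folklore] -/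
theorem secularFn_le_of_neg {E a : ι → ℝ} {s lam : ℝ} (hs : 0 ≤ s) (hE : ∀ k, 0 < E k) (hlam : lam < 0) :
    (s * ∑ k, a k ^ 2 / (E k - lam)) ≤ s * ((∑ k, a k ^ 2) / (-lam)) := by
  refine mul_le_mul_of_nonneg_left ?_ hs
  rw [Finset.sum_div]
  exact Finset.sum_le_sum fun k _ ↦ div_le_div_of_nonneg_left (sq_nonneg _) (by linarith) (by linarith [hE k])

omit [DecidableEq ι] in
/-- **CROSSING ⟺ CAPACITY > 1** (the secular form of XII-l's criterion, with the eigenvector made explicit): for positive rungs,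
`s > 0` and some coupling `a_k ≠ 0`, the ladder pencil has a NEGATIVE secular root — equivalently (by `eigen_of_secular` /
`secular_of_eigen`) a negative eigenvalue, with eigenvector `a_k/(E_k − λ)` — iff `s·Σ a_k²/E_k > 1`; and then it is unique
(`eigenvalue_below_ladder_unique`). [folklore] -/
theorem exists_neg_secular_root_iff {E a : ι → ℝ} {s : ℝ} (hs : 0 < s) (hE : ∀ k, 0 < E k) (ha : ∃ k, a k ≠ 0) :
    (∃ lam : ℝ, lam < 0 ∧ (s * ∑ k, a k ^ 2 / (E k - lam)) = 1) ↔ 1 < s * ∑ k, a k ^ 2 / E k := by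
  constructor
  · rintro ⟨lam, hlam, hsec⟩
    have := secularFn_lt hs hlam (fun k ↦ Or.inr (hE k)) ha
    rwa [hsec, secularFn_zero] at this
  · intro hcap
    set A : ℝ := ∑ k, a k ^ 2 with hA
    have hApos : 0 < A := by
      obtain ⟨k, hk⟩ := ha
      exact lt_of_lt_of_le (by positivity : 0 < a k ^ 2) (Finset.single_le_sum (fun i _ ↦ sq_nonneg (a i)) (Finset.mem_univ k))
    set lam0 : ℝ := -(s * A + 1) with hlam0
    have hsA : 0 < s * A := mul_pos hs hApos
    have hlam0neg : lam0 < 0 := by linarith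
    have hphi0 : (s * ∑ k, a k ^ 2 / (E k - lam0)) < 1 := by
      refine lt_of_le_of_lt (secularFn_le_of_neg hs.le hE hlam0neg) ?_
      have hden : 0 < s * A + 1 := by linarith
      rw [hlam0, neg_neg, ← mul_div_assoc, div_lt_one hden]
      linarith
    have hcont : ContinuousOn (fun lam ↦ (s * ∑ k, a k ^ 2 / (E k - lam))) (Set.Icc lam0 0) :=
      (continuousOn_secularFn s hE).mono fun x hx ↦ hx.2
    have hmem : (1 : ℝ) ∈ Set.Icc ((s * ∑ k, a k ^ 2 / (E k - lam0))) ((s * ∑ k, a k ^ 2 / (E k - 0))) :=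
      ⟨hphi0.le, by rw [secularFn_zero]; exact hcap.le⟩
    obtain ⟨lam, ⟨-, hle⟩, hval⟩ := intermediate_value_Icc hlam0neg.le hcont hmem
    have hval' : (s * ∑ k, a k ^ 2 / (E k - lam)) = 1 := hval
    refine ⟨lam, lt_of_le_of_ne hle fun h ↦ ?_, hval'⟩
    rw [h, secularFn_zero] at hval'
    linarith

/-- Negative eigenvalue of the ladder pencil ⟺ capacity `> 1` (positive rungs, `s > 0`, some `a_k ≠ 0`). [folklore] -/
theorem exists_neg_eigenvalue_iff {E a : ι → ℝ} {s : ℝ} (hs : 0 < s) (hE : ∀ k, 0 < E k) (ha : ∃ k, a k ≠ 0) :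
    (∃ lam : ℝ, lam < 0 ∧ ∃ x : ι → ℝ, x ≠ 0 ∧ (diagonal E - s • vecMulVec a a) *ᵥ x = lam • x) ↔ 1 < s * ∑ k, a k ^ 2 / E k := by
  rw [← exists_neg_secular_root_iff hs hE ha]
  constructor
  · rintro ⟨lam, hlam, x, hx0, hx⟩
    exact ⟨lam, hlam, (secular_of_eigen hx (fun k ↦ by linarith [hE k]) hx0).2.2⟩
  · rintro ⟨lam, hlam, hsec⟩
    obtain ⟨k, hk⟩ := ha
    refine ⟨lam, hlam, fun k ↦ a k / (E k - lam), fun h ↦ hk ?_, eigen_of_secular (fun k ↦ by linarith [hE k]) hsec⟩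
    have := congr_fun h k
    rw [Pi.zero_apply, div_eq_zero_iff] at this
    rcases this with h0 | h0
    · exact h0
    · linarith [hE k]

end Secular

end Summit.RiemannHypothesis.RiemannHypothesis.Theorems.HandoffSecularPencil
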